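/-
Copyright: H21 programme, solo seat `solo-RiemannHypothesis-informed` (session 4).
-/
import Summits.RiemannHypothesis.RiemannHypothesis.Theorems.SoloInformedLocalThreshold

/-!
# The displaced-bump dipole (solo-informed, T15)

The test family that makes the conditional (double-log) threshold theorem elementary: for a fixed
real bump `ψ` supported in `[−1, 1]` and a displacement `c ≥ 0`,
`h_c(t) = ψ(t − c) − ψ(−t − c)` (`bumpDipole ψ c`) is an odd Weil test supported in
`[−(c+1), c+1]`. Its virtue over `sinh(ηt)·b_a(t)`: derivatives of translates are translates of
derivatives, so `‖h_c^{(j)}‖₁ ≤ 2‖ψ^{(j)}‖₁` is INDEPENDENT of `c`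
(`integral_norm_iteratedDeriv_bumpDipole_le`) — no Leibniz expansion is needed — while the gain
is still exponential in `c`:
`∫ h_c(t) e^{ηt} dt = e^{ηc} Φ(η) − e^{−ηc} Φ(−η)`, `Φ(θ) = ∫ ψ(s) e^{θs} ds`
(`integral_bumpDipole_mul_cexp`), hence `≥ e^{ηc} Φ(η) − Φ(−η)` for `ψ ≥ 0`, `η, c ≥ 0`
(`gain_bumpDipole`).

Also: `iteratedDeriv_ofReal_comp` (transport of iterated derivatives through `ℝ ↪ ℂ`) and the
closed form `iteratedDeriv_bumpDipole`.
-/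

open MeasureTheory Complex Set Filter Topology Literature.NumberTheory.LFunctions
open scoped ContDiff

namespace Summit.RiemannHypothesis.RiemannHypothesis.Theorems

/-! ## Transport of iterated derivatives through `ℝ ↪ ℂ` -/

/-- For smooth real `f`: `(↑f)^{(n)} = ↑(f^{(n)})`. -/
theorem iteratedDeriv_ofReal_comp {f : ℝ → ℝ} (hf : ContDiff ℝ ∞ f) (n : ℕ) :
    iteratedDeriv n (fun t ↦ ((f t : ℝ) : ℂ)) = fun t ↦ ((iteratedDeriv n f t : ℝ) : ℂ) := by
  induction n generalizing f with
  | zero => simp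
  | succ n ih =>
    have hd : Differentiable ℝ f := (contDiff_infty_iff_deriv.mp hf).1
    have h1 : deriv (fun t ↦ ((f t : ℝ) : ℂ)) = fun t ↦ ((deriv f t : ℝ) : ℂ) := by
      funext t; exact (hd t).hasDerivAt.ofReal_comp.deriv
    rw [iteratedDeriv_succ', h1, ih (contDiff_infty_iff_deriv.mp hf).2, ← iteratedDeriv_succ']

/-! ## The family -/

/-- The displaced-bump dipole `h_c(t) = ψ(t − c) − ψ(−t − c)`. -/
noncomputable def bumpDipole (ψ : ℝ → ℝ) (c : ℝ) : ℝ → ℂ :=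
  fun t ↦ ((ψ (t - c) - ψ (-t - c) : ℝ) : ℂ)

/-- The two-sided Laplace transform `Φ(θ) = ∫ ψ(s) e^{θs} ds` of the bump. -/
noncomputable def bumpLaplace (ψ : ℝ → ℝ) (θ : ℝ) : ℝ := ∫ s, ψ s * Real.exp (θ * s)

variable {ψ : ℝ → ℝ}

/-- `h_c` is odd. -/
theorem bumpDipole_odd (ψ : ℝ → ℝ) (c t : ℝ) : bumpDipole ψ c (-t) = -bumpDipole ψ c t := by
  simp only [bumpDipole, neg_neg]
  push_cast; ring

/-- `h_c` is smooth. -/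
theorem contDiff_bumpDipole (hψ : ContDiff ℝ ∞ ψ) (c : ℝ) : ContDiff ℝ ∞ (bumpDipole ψ c) :=
  ofRealCLM.contDiff.comp ((hψ.comp (contDiff_id.sub contDiff_const)).sub
    (hψ.comp (contDiff_neg.sub contDiff_const)))

/-- A translate `ψ(t − c)` is supported in `[c − 1, c + 1]`. -/
theorem support_comp_sub_subset (hsupp : tsupport ψ ⊆ Icc (-1) 1) (c : ℝ) :
    Function.support (fun t ↦ ψ (t - c)) ⊆ Icc (c - 1) (c + 1) := by
  intro t ht
  have h := hsupp (subset_tsupport _ (Function.mem_support.mpr (Function.mem_support.mp ht)))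
  rw [mem_Icc] at h ⊢
  constructor <;> linarith [h.1, h.2]

/-- A reflected translate `ψ(−t − c)` is supported in `[−c − 1, −c + 1]`. -/
theorem support_comp_neg_sub_subset (hsupp : tsupport ψ ⊆ Icc (-1) 1) (c : ℝ) :
    Function.support (fun t ↦ ψ (-t - c)) ⊆ Icc (-c - 1) (-c + 1) := by
  intro t ht
  have h := hsupp (subset_tsupport _ (Function.mem_support.mpr (Function.mem_support.mp ht)))
  rw [mem_Icc] at h ⊢
  constructor <;> linarith [h.1, h.2]

/-- `ψ` itself has compact support. -/
theorem hasCompactSupport_of_tsupport_subset (hsupp : tsupport ψ ⊆ Icc (-1) 1) :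
    HasCompactSupport ψ :=
  HasCompactSupport.of_support_subset_isCompact isCompact_Icc ((subset_tsupport ψ).trans hsupp)

/-- `supp h_c ⊆ [−(c+1), c+1]` for `c ≥ 0`. -/
theorem support_bumpDipole_subset (hsupp : tsupport ψ ⊆ Icc (-1) 1) {c : ℝ} (hc : 0 ≤ c) :
    Function.support (bumpDipole ψ c) ⊆ Icc (-(c + 1)) (c + 1) := by
  intro t ht
  rw [Function.mem_support] at ht
  by_contra hI
  apply ht
  have h1 : ψ (t - c) = 0 := by
    by_contra h
    have := support_comp_sub_subset hsupp c (Function.mem_support.mpr h)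
    rw [mem_Icc] at this
    exact hI (mem_Icc.mpr ⟨by linarith [this.1], by linarith [this.2]⟩)
  have h2 : ψ (-t - c) = 0 := by
    by_contra h
    have := support_comp_neg_sub_subset hsupp c (Function.mem_support.mpr h)
    rw [mem_Icc] at this
    exact hI (mem_Icc.mpr ⟨by linarith [this.1], by linarith [this.2]⟩)
  simp [bumpDipole, h1, h2]

/-- `tsupport h_c ⊆ [−(c+1), c+1]` for `c ≥ 0`. -/
theorem tsupport_bumpDipole_subset (hsupp : tsupport ψ ⊆ Icc (-1) 1) {c : ℝ} (hc : 0 ≤ c) :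
    tsupport (bumpDipole ψ c) ⊆ Icc (-(c + 1)) (c + 1) :=
  closure_minimal (support_bumpDipole_subset hsupp hc) isClosed_Icc

/-- `h_c` has compact support (`c ≥ 0`). -/
theorem hasCompactSupport_bumpDipole (hsupp : tsupport ψ ⊆ Icc (-1) 1) {c : ℝ} (hc : 0 ≤ c) :
    HasCompactSupport (bumpDipole ψ c) :=
  HasCompactSupport.of_support_subset_isCompact isCompact_Icc (support_bumpDipole_subset hsupp hc)

/-- `h_c` is a Weil test function. -/
theorem isWeilTest_bumpDipole (hψ : ContDiff ℝ ∞ ψ) (hsupp : tsupport ψ ⊆ Icc (-1) 1) {c : ℝ}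
    (hc : 0 ≤ c) : IsWeilTest (bumpDipole ψ c) :=
  ⟨contDiff_bumpDipole hψ c, hasCompactSupport_bumpDipole hsupp hc⟩

/-! ## Derivatives: translates of `ψ^{(j)}` -/

/-- `h_c^{(j)}(t) = ψ^{(j)}(t − c) − (−1)^j ψ^{(j)}(−t − c)`. -/
theorem iteratedDeriv_bumpDipole (hψ : ContDiff ℝ ∞ ψ) (c : ℝ) (j : ℕ) :
    iteratedDeriv j (bumpDipole ψ c) = fun t ↦
      ((iteratedDeriv j ψ (t - c) - (-1) ^ j * iteratedDeriv j ψ (-t - c) : ℝ) : ℂ) := by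
  have hf : ContDiff ℝ ∞ (fun t ↦ ψ (t - c)) := hψ.comp (contDiff_id.sub contDiff_const)
  have hg : ContDiff ℝ ∞ (fun t ↦ ψ (-t - c)) := hψ.comp (contDiff_neg.sub contDiff_const)
  have hreal : ContDiff ℝ ∞ (fun t ↦ ψ (t - c) - ψ (-t - c)) := hf.sub hg
  have h1 : bumpDipole ψ c = fun t ↦ (((fun t ↦ ψ (t - c) - ψ (-t - c)) t : ℝ) : ℂ) := rfl
  rw [h1, iteratedDeriv_ofReal_comp hreal j]
  funext t
  have hfj : ContDiffAt ℝ j (fun t ↦ ψ (t - c)) t := (hf.of_le (by exact_mod_cast le_top)).contDiffAt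
  have hgj : ContDiffAt ℝ j (fun t ↦ ψ (-t - c)) t := (hg.of_le (by exact_mod_cast le_top)).contDiffAt
  have h2 : iteratedDeriv j (fun x ↦ ψ (-x - c)) t = (-1 : ℝ) ^ j • iteratedDeriv j (fun z ↦ ψ (z - c)) (-t) :=
    iteratedDeriv_comp_neg j (fun z ↦ ψ (z - c)) t
  have h3 : (fun t ↦ ψ (t - c) - ψ (-t - c)) = (fun t ↦ ψ (t - c)) - fun t ↦ ψ (-t - c) := rfl
  rw [h3, iteratedDeriv_sub hfj hgj, h2, iteratedDeriv_comp_sub_const, smul_eq_mul]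

/-- `ψ^{(j)}` is continuous. -/
theorem continuous_iteratedDeriv_bump (hψ : ContDiff ℝ ∞ ψ) (j : ℕ) :
    Continuous (iteratedDeriv j ψ) :=
  hψ.continuous_iteratedDeriv j (by exact_mod_cast le_top)

/-- `ψ^{(j)}` is integrable. -/
theorem integrable_iteratedDeriv_bump (hψ : ContDiff ℝ ∞ ψ) (hsupp : tsupport ψ ⊆ Icc (-1) 1)
    (j : ℕ) : Integrable (iteratedDeriv j ψ) := by
  refine (continuous_iteratedDeriv_bump hψ j).integrable_of_hasCompactSupport ?_
  have h : iteratedDeriv j ψ = (fun L : (ℝ [×j]→L[ℝ] ℝ) ↦ L fun _ ↦ 1) ∘ iteratedFDeriv ℝ j ψ := by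
    ext x; rfl
  rw [h]
  exact ((hasCompactSupport_of_tsupport_subset hsupp).iteratedFDeriv j).comp_left (by simp)

/-- **`c`-independent derivative norms.** `‖h_c^{(j)}‖₁ ≤ 2‖ψ^{(j)}‖₁`. -/
theorem integral_norm_iteratedDeriv_bumpDipole_le (hψ : ContDiff ℝ ∞ ψ)
    (hsupp : tsupport ψ ⊆ Icc (-1) 1) (c : ℝ) (j : ℕ) :
    ∫ t, ‖iteratedDeriv j (bumpDipole ψ c) t‖ ≤ 2 * ∫ s, |iteratedDeriv j ψ s| := by
  rw [iteratedDeriv_bumpDipole hψ c j]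
  set D := iteratedDeriv j ψ with hD
  have hDi : Integrable D := integrable_iteratedDeriv_bump hψ hsupp j
  have hA : Integrable fun t ↦ |D (t - c)| := (hDi.comp_sub_right c).abs
  have hB : Integrable fun t ↦ |D (-t - c)| := by
    have : (fun t ↦ |D (-t - c)|) = fun t ↦ (fun s ↦ |D (s - c)|) (-t) := rfl
    rw [this]
    exact (hDi.comp_sub_right c).abs.comp_neg
  calc ∫ t, ‖((D (t - c) - (-1) ^ j * D (-t - c) : ℝ) : ℂ)‖
      ≤ ∫ t, (|D (t - c)| + |D (-t - c)|) := by
        refine integral_mono_of_nonneg (Eventually.of_forall fun t ↦ norm_nonneg _) (hA.add hB)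
          (Eventually.of_forall fun t ↦ ?_)
        simp only [Complex.norm_real, Real.norm_eq_abs]
        refine (abs_sub _ _).trans ?_
        rw [abs_mul, abs_pow, abs_neg, abs_one, one_pow, one_mul]
    _ = (∫ t, |D (t - c)|) + ∫ t, |D (-t - c)| := integral_add hA hB
    _ = (∫ t, |D t|) + ∫ t, |D t| := by
        congr 1
        · exact integral_sub_right_eq_self (fun t ↦ |D t|) c
        · have h1 : (fun t ↦ |D (-t - c)|) = fun t ↦ (fun s ↦ |D (-s)|) (t + c) := by
            funext t; simp only [neg_add]; ring_nf
          rw [h1, integral_add_right_eq_self (fun s ↦ |D (-s)|) c]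
          exact integral_neg_eq_self (fun s ↦ |D s|) volume
    _ = 2 * ∫ s, |D s| := by ring

/-! ## The gain -/

/-- **Gain identity.** `∫ h_c(t) e^{ηt} dt = e^{ηc} Φ(η) − e^{−ηc} Φ(−η)`. -/
theorem integral_bumpDipole_mul_cexp (hψ : Continuous ψ) (hsupp : tsupport ψ ⊆ Icc (-1) 1)
    (c η : ℝ) :
    ∫ t, bumpDipole ψ c t * cexp ((η : ℂ) * t) =
      ((Real.exp (η * c) * bumpLaplace ψ η - Real.exp (-(η * c)) * bumpLaplace ψ (-η) : ℝ) : ℂ) := by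
  have hsplit : ∀ t : ℝ, bumpDipole ψ c t * cexp ((η : ℂ) * t) =
      ((ψ (t - c) * Real.exp (η * t) - ψ (-t - c) * Real.exp (η * t) : ℝ) : ℂ) := by
    intro t
    unfold bumpDipole
    rw [show ((η : ℂ) * t) = ((η * t : ℝ) : ℂ) by push_cast; ring, ← Complex.ofReal_exp]
    push_cast; ring
  simp_rw [hsplit]
  rw [integral_complex_ofReal]
  congr 1
  have hψc : HasCompactSupport ψ := hasCompactSupport_of_tsupport_subset hsupp
  have hec : Continuous fun t : ℝ ↦ Real.exp (η * t) := by fun_prop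
  have hA : Integrable fun t ↦ ψ (t - c) * Real.exp (η * t) :=
    ((hψ.comp (continuous_id.sub continuous_const)).mul hec).integrable_of_hasCompactSupport
      ((HasCompactSupport.of_support_subset_isCompact isCompact_Icc
        (support_comp_sub_subset hsupp c)).mul_right)
  have hB : Integrable fun t ↦ ψ (-t - c) * Real.exp (η * t) :=
    ((hψ.comp (continuous_neg.sub continuous_const)).mul hec).integrable_of_hasCompactSupport
      ((HasCompactSupport.of_support_subset_isCompact isCompact_Icc
        (support_comp_neg_sub_subset hsupp c)).mul_right)
  rw [integral_sub hA hB]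
  -- first piece: translate by `c`
  have h1 : ∫ t, ψ (t - c) * Real.exp (η * t) = Real.exp (η * c) * bumpLaplace ψ η := by
    have e1 : (fun t ↦ ψ (t - c) * Real.exp (η * t)) =
        fun t ↦ (fun s ↦ ψ s * Real.exp (η * (s + c))) (t - c) := by
      funext t; simp only [sub_add_cancel]
    rw [e1, integral_sub_right_eq_self (fun s ↦ ψ s * Real.exp (η * (s + c))) c]
    unfold bumpLaplace
    rw [← integral_const_mul]
    congr 1; funext s
    rw [mul_add, Real.exp_add]; ring
  -- second piece: translate by `-c`, then reflect
  have h2 : ∫ t, ψ (-t - c) * Real.exp (η * t) = Real.exp (-(η * c)) * bumpLaplace ψ (-η) := by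
    have e1 : (fun t ↦ ψ (-t - c) * Real.exp (η * t)) =
        fun t ↦ (fun s ↦ ψ (-s) * Real.exp (η * (s - c))) (t + c) := by
      funext t; simp only [add_sub_cancel_right, neg_add]; ring_nf
    rw [e1, integral_add_right_eq_self (fun s ↦ ψ (-s) * Real.exp (η * (s - c))) c]
    have e2 : ∫ s, ψ (-s) * Real.exp (η * (s - c)) =
        Real.exp (-(η * c)) * ∫ s, ψ (-s) * Real.exp (η * s) := by
      rw [← integral_const_mul]
      congr 1; funext s
      rw [mul_sub, Real.exp_sub, Real.exp_neg]; ring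
    rw [e2]
    congr 1
    unfold bumpLaplace
    rw [← integral_neg_eq_self (fun s ↦ ψ s * Real.exp (-η * s)) volume]
    congr 1; funext s
    congr 1; ring_nf
  rw [h1, h2]

/-- `Φ(θ) ≥ 0` for `ψ ≥ 0`. -/
theorem bumpLaplace_nonneg (hψ0 : ∀ s, 0 ≤ ψ s) (θ : ℝ) : 0 ≤ bumpLaplace ψ θ :=
  integral_nonneg fun s ↦ mul_nonneg (hψ0 s) (Real.exp_nonneg _)

/-- **Gain lower bound.** For `ψ ≥ 0`, `η ≥ 0`, `c ≥ 0`: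
`e^{ηc} Φ(η) − Φ(−η) ≤ ‖∫ h_c(t) e^{ηt} dt‖`. -/
theorem gain_bumpDipole (hψ : Continuous ψ) (hsupp : tsupport ψ ⊆ Icc (-1) 1)
    (hψ0 : ∀ s, 0 ≤ ψ s) {η c : ℝ} (hη : 0 ≤ η) (hc : 0 ≤ c) :
    Real.exp (η * c) * bumpLaplace ψ η - bumpLaplace ψ (-η) ≤
      ‖∫ t, bumpDipole ψ c t * cexp ((η : ℂ) * t)‖ := by
  rw [integral_bumpDipole_mul_cexp hψ hsupp, Complex.norm_real, Real.norm_eq_abs]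
  refine le_trans ?_ (le_abs_self _)
  have h1 : Real.exp (-(η * c)) ≤ 1 := Real.exp_le_one_iff.mpr (by nlinarith)
  have h2 := bumpLaplace_nonneg hψ0 (-η)
  nlinarith [mul_le_of_le_one_left h2 h1]

end Summit.RiemannHypothesis.RiemannHypothesis.Theorems
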